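import Summits.AtomisticToContinuum.HydrodynamicLimit.Theses.LambertianContactSwap
import Summits.AtomisticToContinuum.HydrodynamicLimit.Theorems.LambertianContactSwapMergingTransfer
import Literature.MathematicalPhysics.KineticTheory.LambertianHardSphereFlow
import Literature.MathematicalPhysics.KineticTheory.HardSphereEulerProofs
import HarnessLib

/-!
# `LambertianEuler` from `SwapGap` and the (unguarded) hydrodynamic limit — mirror of `closes`

Helper file (`--supports stmt-AtomisticToContinuum-11850`) of line `Sketch` for the crux
`Summit.AtomisticToContinuum.HydrodynamicLimit.Theses.LambertianContactSwap.SwapGap`, stub T4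
`stub_lambertianEuler_of_swapGap_of_hydrodynamicLimit`: the Markov/Portmanteau transfer of the route's
deciding theorem `closes : SwapGap → LambertianEuler → HydrodynamicLimit` run in the other direction,
from the deterministic flow `Φ` to the Lambertian flow `Λ`.

Mathematics (Billingsley 1999 Thm. 2.1 / Dudley 2002 §11.3 bookkeeping between two sequences of
laws). Fix profiles, `σ₀ := min (1/2) (min σ_S σ_H)`. For `σ < σ₀`, Euler data, flows, the `t = 0`
hypothesis, `t < T`, continuous `χ` and `δ > 0`, put `c := ∫χρ_t` and
`g(x) := min 1 (max (x - δ/2) 0)` (`1`-Lipschitz, values in `[0, 1]`, `g ≥ min 1 (δ/2)` on `{δ < x}`,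
`g = 0` on `{x ≤ δ/2}`). Then
`min(1, δ/2) · (P_N ⊗ γ^ℕ){δ < |ρ_N(Λ_t; χ) - c|} ≤ ∫ g|ρ_N(Λ_t; χ) - c| d(P_N ⊗ γ^ℕ)` (Markov;
`Λ_t` is jointly measurable for `σ < 1/2`, `measurable_lambertFlow_hsDiameter`, and `P_N ⊗ γ^ℕ` is a
probability measure for `σ ≤ 1/2`) `= ∫ g|ρ_N(Φ_t z; χ) - c| dP_N + o(1)` (`SwapGap` with the
`1`-Lipschitz test function `F(d, m, e) := g|d - c|`, sign reversed)
`≤ P_N{δ/2 < |ρ_N(Φ_t z; χ) - c|} + o(1) → 0` (the hydrodynamic limit at `δ/2`). The same with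
`‖m - ∫χρu‖` and the energy; the abstract form is `tendsto_measure_setOf_lt_of_merging`
(`Theorems/LambertianContactSwapMergingTransfer.lean`), applied with the roles of the two sequences of
laws exchanged.

On the hypothesis. The hydrodynamic-limit hypothesis is the UNGUARDED Literature conjecture
`Literature.MathematicalPhysics.KineticTheory.HydrodynamicLimit` (for all profiles, `∃ σ₀`, for all
`σ < σ₀`, `HydrodynamicLimitFor σ`), which has the same quantifier prefix as `LambertianEuler` and
`SwapGap`. Since the statement re-type of 2026-08-16 (D-0032) the summit conjunct
`_root_.HydrodynamicLimit` is the PACKING-GUARDED form (`∃ η₀`, solutions with `ρ_t σ³ < η₀` only);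
it is implied by the unguarded one (`HydrodynamicLimit.of_unguarded`) but says nothing about Euler
solutions outside the guard, whereas `LambertianEuler` quantifies over all of them, so the guarded
conjunct cannot feed this transfer.

prover-line-stmt-AtomisticToContinuum-11850-c5-0, cycle 5.
-/

noncomputable section

open MeasureTheory Filter Set Topology
open scoped ENNReal

namespace Summit.AtomisticToContinuum.HydrodynamicLimit.Theorems

open Literature.Analysis.FluidPDE Literature.MathematicalPhysics.KineticTheory
open Summit.AtomisticToContinuum.HydrodynamicLimit.Theses.LambertianContactSwap

/-- **T4 · mirror of the deciding theorem.** `SwapGap` (bounded-Lipschitz merging of the `χ`-tested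
field laws of `Φ_t` under `P_N` and of the Lambertian flow `Λ_t` under `P_N ⊗ γ^ℕ`) and the
unguarded hydrodynamic limit (convergence in `P_N`-probability of `Φ`'s fields to the Euler values)
give `LambertianEuler` (convergence in `P_N ⊗ γ^ℕ`-probability of `Λ`'s fields): with
`σ₀ := min (1/2) (min σ_S σ_H)`, each of the three deviation probabilities is transferred by
`tendsto_measure_setOf_lt_of_merging` (Markov with the cutoff `g_δ` on the `Λ` side — `Λ_t` jointly
measurable by `measurable_lambertFlow_hsDiameter`, `P_N ⊗ γ^ℕ` a probability measure by
`isProbabilityMeasure_localGibbsLaw` and `isProbabilityMeasure_lambertNoise` — the merging hypothesis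
with the sign reversed for the `1`-Lipschitz test function `g_δ ∘ |· - c| ∘ proj`, and the
hydrodynamic limit at `δ/2`). [cite: Dudley2002, §11.3] -/
theorem stub_lambertianEuler_of_swapGap_of_hydrodynamicLimit (hS : SwapGap)
    (hH : Literature.MathematicalPhysics.KineticTheory.HydrodynamicLimit) : LambertianEuler := by
  delta Summit.AtomisticToContinuum.HydrodynamicLimit.Theses.LambertianContactSwap.LambertianEuler
  intro Cfg G ε τ S ldir lpair lstep lstate linst lflow noise a₀ θ₀ u₀ ha hθ hu ha0 hθ0
  obtain ⟨σS, hσS, hS'⟩ := hS a₀ θ₀ u₀ ha hθ hu ha0 hθ0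
  obtain ⟨σH, hσH, hH'⟩ := hH a₀ θ₀ u₀ ha hθ hu ha0 hθ0
  refine ⟨min 2⁻¹ (min σS σH), lt_min (by norm_num) (lt_min hσS hσH), ?_⟩
  intro σ hσ hσlt T ρ θ u hE Φ P h0 t ht χ hχ δ hδ
  have hσhalf : σ < 2⁻¹ := hσlt.trans_le (min_le_left _ _)
  have hσS' : σ < σS := hσlt.trans_le ((min_le_right _ _).trans (min_le_left _ _))
  have hσH' : σ < σH := hσlt.trans_le ((min_le_right _ _).trans (min_le_right _ _))
  -- the two inputs at time `t`
  have hSw := hS' σ hσ hσS' T ρ θ u hE Φ h0 t ht χ hχ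
  have hHt := hH' σ hσ hσH' T ρ θ u hE Φ h0 t ht χ hχ
  clear hS' hH'
  -- probability instances
  have hPN : ∀ N, IsProbabilityMeasure (P N) := fun N =>
    isProbabilityMeasure_localGibbsLaw ha hθ hu ha0 hθ0 (hσhalf.le.trans_eq (one_div 2).symm) N (Φ N)
  have hnoise : IsProbabilityMeasure noise := by
    show IsProbabilityMeasure (lambertNoise (Fin 3))
    infer_instance
  have hμ : ∀ N, IsFiniteMeasure ((P N).prod noise) := fun N => by
    haveI := hPN N
    infer_instance
  -- the three Euler values at time `t`
  set cD : ℝ := ∫ x, χ x * ρ t x with hcD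
  set cM : V3 := ∫ x, (χ x * ρ t x) • u t x with hcM
  set cE : ℝ := ∫ x, χ x * totalEnergyDensity (ρ t x) (u t x) (θ t x) with hcE
  -- joint measurability of the Lambertian flow, and of the three Lambertian deviations
  have hΛ : ∀ N, Measurable fun p : Cfg N × (ℕ → EuclideanSpace ℝ (Fin 3)) => lflow σ N p.2 p.1 t :=
    fun N => measurable_lambertFlow_hsDiameter hσ.le hσhalf N t
  have hXD : ∀ N, Measurable fun p : Cfg N × (ℕ → EuclideanSpace ℝ (Fin 3)) =>
      |empiricalDensityField (lflow σ N p.2 p.1 t) χ - cD| := fun N =>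
    (((measurable_empiricalDensityField hχ).comp (hΛ N)).sub measurable_const).abs
  have hXM : ∀ N, Measurable fun p : Cfg N × (ℕ → EuclideanSpace ℝ (Fin 3)) =>
      ‖empiricalMomentumField (lflow σ N p.2 p.1 t) χ - cM‖ := fun N =>
    (((measurable_empiricalMomentumField hχ).comp (hΛ N)).sub measurable_const).norm
  have hXE : ∀ N, Measurable fun p : Cfg N × (ℕ → EuclideanSpace ℝ (Fin 3)) =>
      |empiricalEnergyField (lflow σ N p.2 p.1 t) χ - cE| := fun N =>
    (((measurable_empiricalEnergyField hχ).comp (hΛ N)).sub measurable_const).abs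
  -- `SwapGap` with the sign reversed: `∫ F(fld Λ_t) d(P_N ⊗ γ^ℕ) - ∫ F(fld Φ_t) dP_N → 0`
  have hSw' : ∀ F : ℝ × V3 × ℝ → ℝ, LipschitzWith 1 F → (∀ y, |F y| ≤ 1) →
      Tendsto (fun N : ℕ => (∫ p, F (empiricalDensityField (lflow σ N p.2 p.1 t) χ,
          empiricalMomentumField (lflow σ N p.2 p.1 t) χ,
          empiricalEnergyField (lflow σ N p.2 p.1 t) χ) ∂((P N).prod noise)) -
        ∫ z, F (empiricalDensityField ((Φ N).flow t z) χ,
          empiricalMomentumField ((Φ N).flow t z) χ,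
          empiricalEnergyField ((Φ N).flow t z) χ) ∂(P N)) atTop (𝓝 0) := by
    intro F hF hF1
    have h := (hSw F hF hF1).neg
    rw [neg_zero] at h
    exact h.congr fun N => neg_sub _ _
  refine ⟨?_, ?_, ?_⟩
  · exact tendsto_measure_setOf_lt_of_merging (fun N => (P N).prod noise) (fun N => P N) hμ
      (fun N p => |empiricalDensityField (lflow σ N p.2 p.1 t) χ - cD|)
      (fun N z => |empiricalDensityField ((Φ N).flow t z) χ - cD|) hXD
      (fun g hg hg1 => hSw' (fun y => g |y.1 - cD|) (lipschitzWith_densityTest hg cD)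
        fun y => hg1 _)
      (fun δ' hδ' => (hHt δ' hδ').1) hδ
  · exact tendsto_measure_setOf_lt_of_merging (fun N => (P N).prod noise) (fun N => P N) hμ
      (fun N p => ‖empiricalMomentumField (lflow σ N p.2 p.1 t) χ - cM‖)
      (fun N z => ‖empiricalMomentumField ((Φ N).flow t z) χ - cM‖) hXM
      (fun g hg hg1 => hSw' (fun y => g ‖y.2.1 - cM‖) (lipschitzWith_momentumTest hg cM)
        fun y => hg1 _)
      (fun δ' hδ' => (hHt δ' hδ').2.1) hδ
  · exact tendsto_measure_setOf_lt_of_merging (fun N => (P N).prod noise) (fun N => P N) hμ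
      (fun N p => |empiricalEnergyField (lflow σ N p.2 p.1 t) χ - cE|)
      (fun N z => |empiricalEnergyField ((Φ N).flow t z) χ - cE|) hXE
      (fun g hg hg1 => hSw' (fun y => g |y.2.2 - cE|) (lipschitzWith_energyTest hg cE)
        fun y => hg1 _)
      (fun δ' hδ' => (hHt δ' hδ').2.2) hδ

end Summit.AtomisticToContinuum.HydrodynamicLimit.Theorems
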